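import Mathlib
import Summits.NavierStokesRegularity.FluidComputer.AbcLatticeTailCoercivity
import Summits.NavierStokesRegularity.FluidComputer.SkewCutBracketTranscript
import Summits.NavierStokesRegularity.FluidComputer.SkewCutBracketReproductions
import HarnessLib

/-!
# The TAIL step of the X0 brackets is kernel end-to-end: the transcribed tail constants of the two
# certifiers drive the operator inequality `Re⟨c, (x − L_R)c⟩ ≥ μ‖c‖²` outside the head cube
# (ASSEMBLY obligation (A4), tail half, of `HOME/instab4/KERNEL-CHAIN.md`, at the numbers of record;
# instab4 g5 — implementation 2 of the X0 chain, cell `ns-blowup`, 2026-08-26)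

HONEST FRAMING (human ruling D-0035): nothing here is a claim about Navier–Stokes blow-up.
WHAT THIS IS NOT: not NS evidence; MODEL lane (linearisation of forced Navier–Stokes about the
exact steady ABC state `U = Torus.abcFlow 1 1 1`, certifier units `L_R = −(1/R)|k|² + Π X`). No
certificate and no census word is moved by this file: it CONNECTS two kernel objects that existed
separately — the transcribed EXACT-RATIONAL tail hypotheses `2 < (x₁ + (K+1)²/R)²` of the brackets
(`SkewCutBracketTranscript.X0R800/X0R1000.tail_gt_sqrt_two_i4/_i3`,
`SkewCutBracketReproductions.X0R100/X0R300/X0R500.…`, kit jobs cited there) and the operator inequality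
`AbcLatticeTailCoercivity.tail_coercive_sum`. Unlike the HEAD (determinant signs) and the SHELL
(`MU2_K`) steps, the tail step needs NO class-II basis: coercivity on ALL transversal mean-free
families supported outside the cube implies it on the class-II ones. Hence, at the numbers of record,
the tail half of (A4) is kernel with no residue other than the CERTIFIER AUDIT of the transcription.

* §1 `sqrt_two_lt_of_transcript` — `2 < (x₁ + (K+1)²/R)²` and `0 < x₁` (in `ℚ`) give
  `√2 < x₁ + (K+1)²/R` (in `ℝ`); `tail_coercive_of_transcript` — for every `x ≥ x₁` and every finitely
  supported transversal mean-free `c` supported where `|k|² ≥ (K+1)²`: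
  `0 < μ := x + (K+1)²/R − √2` and `μ Σ‖c(k)‖² ≤ Re Σ ⟪c(k), (x + |k|²/R)c(k) − Π_k Xc(k)⟫`.
* §2 the ten instances of record: `R ∈ {100, 300, 500, 800, 1000}` × levels `K4` (cert.py) / `K3`
  (i3cert).

Mathlib + the files named; no new definitions, no named facts.
-/

noncomputable section

open scoped BigOperators ComplexConjugate Matrix InnerProductSpace
open Filter Set Function MeasureTheory UnitAddTorus

namespace Summit.NavierStokesRegularity.FluidComputer.AbcLatticeTailBrackets

open Literature.Analysis.FunctionSpaces Literature.Analysis.FunctionSpaces.Torus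
open Literature.Analysis.FunctionSpaces.EuclideanSpace
open Literature.Analysis.FluidPDE Literature.Analysis.FluidPDE.ScalarFourier
open Literature.Analysis.FluidPDE.SteadyLattice
open AbcLatticeTailCoercivity

/-! ## §1 From the transcribed rational inequality to the operator inequality -/

/-- `2 < (x₁ + (K+1)²/R)²` with `0 < x₁` (exact rationals, as transcribed) gives
`√2 < x₁ + (K+1)²/R` over `ℝ`. [folklore] -/
theorem sqrt_two_lt_of_transcript {Rn Kn : ℕ} {xq : ℚ} (hx0 : 0 < xq)
    (htail : 2 < (xq + ((Kn + 1) ^ 2 : ℚ) / Rn) ^ 2) :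
    Real.sqrt 2 < (xq : ℝ) + ((Kn : ℝ) + 1) ^ 2 / (Rn : ℝ) := by
  have hb : (0 : ℚ) ≤ xq + ((Kn + 1) ^ 2 : ℚ) / Rn := by positivity
  have h2 : (2 : ℝ) < ((xq : ℝ) + ((Kn : ℝ) + 1) ^ 2 / (Rn : ℝ)) ^ 2 := by
    have h := (Rat.cast_lt (K := ℝ)).mpr htail
    push_cast at h
    exact h
  have hb' : (0 : ℝ) ≤ (xq : ℝ) + ((Kn : ℝ) + 1) ^ 2 / (Rn : ℝ) := by
    have h := (Rat.cast_le (K := ℝ)).mpr hb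
    push_cast at h
    exact h
  calc Real.sqrt 2 < Real.sqrt (((xq : ℝ) + ((Kn : ℝ) + 1) ^ 2 / (Rn : ℝ)) ^ 2) :=
        Real.sqrt_lt_sqrt (by norm_num) h2
    _ = (xq : ℝ) + ((Kn : ℝ) + 1) ^ 2 / (Rn : ℝ) := Real.sqrt_sq hb'

/-- **Tail coercivity at transcribed data.** From a bracket's transcribed `0 < x₁`,
`2 < (x₁ + (K+1)²/R)²` and `0 < R`: for every `x ≥ x₁` and every finitely supported transversal
mean-free family `c` supported where `|k|² ≥ (K+1)²`, the constant `μ = x + (K+1)²/R − √2` is positive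
and `μ Σ‖c(k)‖² ≤ Re Σ ⟪c(k), (x + |k|²/R)c(k) − Π_k Xc(k)⟫` (`tail_coercive_sum`). MODEL statement;
not NS. -/
theorem tail_coercive_of_transcript {Rn Kn : ℕ} {xq : ℚ} (hx0 : 0 < xq)
    (htail : 2 < (xq + ((Kn + 1) ^ 2 : ℚ) / Rn) ^ 2) (hRn : 0 < Rn) {x : ℝ} (hx : (xq : ℝ) ≤ x)
    (c : (Fin 3 → ℤ) → EuclideanSpace ℂ (Fin 3)) (F : Finset (Fin 3 → ℤ)) (hcF : ∀ k ∉ F, c k = 0)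
    (hc0 : c 0 = 0) (hdiv : ∀ k : Fin 3 → ℤ, (∑ jj : Fin 3, ((k jj : ℤ) : ℂ) * (c k) jj) = 0)
    (hm : ∀ k ∈ F, ((Kn : ℝ) + 1) ^ 2 ≤ freqNormSq k) :
    0 < x + ((Kn : ℝ) + 1) ^ 2 / (Rn : ℝ) - Real.sqrt 2 ∧
    (x + ((Kn : ℝ) + 1) ^ 2 / (Rn : ℝ) - Real.sqrt 2) * ∑ k ∈ F, ‖c k‖ ^ 2 ≤
      (∑ k ∈ F, ⟪c k, ((x + freqNormSq k / (Rn : ℝ) : ℝ) : ℂ) • c k -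
        Torus.lerayCoeff k (∑ s ∈ Torus.abcFreq,
          (WithLp.toLp 2 (crossProduct (WithLp.ofLp (Torus.abcCoeff 1 1 1 s))
            (Complex.I • crossProduct (fun j => (((k - s) j : ℤ) : ℂ)) (WithLp.ofLp (c (k - s))) -
              WithLp.ofLp (c (k - s)))) : EuclideanSpace ℂ (Fin 3)))⟫_ℂ).re := by
  have hR : (0 : ℝ) < (Rn : ℝ) := by exact_mod_cast hRn
  refine ⟨?_, tail_coercive_sum hR x (((Kn : ℝ) + 1) ^ 2) c F hcF hc0 hdiv hm⟩
  have h := sqrt_two_lt_of_transcript hx0 htail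
  linarith

/-! ## §2 The ten instances of record (five Reynolds numbers × the two implementations' levels) -/

/-- Tail coercivity of `x − L_R` outside the cube of level `K4` at the **R = 100 bracket** (`x ≥ x₁ = SkewCutBracketReproductions.X0R100.x1`),
from the transcribed `SkewCutBracketReproductions.X0R100.tail_gt_sqrt_two_i4` (MODEL; not NS). -/
theorem tail_coercive_R100_i4 {x : ℝ} (hx : (SkewCutBracketReproductions.X0R100.x1 : ℝ) ≤ x)
    (c : (Fin 3 → ℤ) → EuclideanSpace ℂ (Fin 3)) (F : Finset (Fin 3 → ℤ)) (hcF : ∀ k ∉ F, c k = 0)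
    (hc0 : c 0 = 0) (hdiv : ∀ k : Fin 3 → ℤ, (∑ jj : Fin 3, ((k jj : ℤ) : ℂ) * (c k) jj) = 0)
    (hm : ∀ k ∈ F, ((SkewCutBracketReproductions.X0R100.K4 : ℝ) + 1) ^ 2 ≤ freqNormSq k) :
    0 < x + ((SkewCutBracketReproductions.X0R100.K4 : ℝ) + 1) ^ 2 / (SkewCutBracketReproductions.X0R100.R : ℝ) - Real.sqrt 2 ∧
    (x + ((SkewCutBracketReproductions.X0R100.K4 : ℝ) + 1) ^ 2 / (SkewCutBracketReproductions.X0R100.R : ℝ) - Real.sqrt 2) * ∑ k ∈ F, ‖c k‖ ^ 2 ≤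
      (∑ k ∈ F, ⟪c k, ((x + freqNormSq k / (SkewCutBracketReproductions.X0R100.R : ℝ) : ℝ) : ℂ) • c k -
        Torus.lerayCoeff k (∑ s ∈ Torus.abcFreq,
          (WithLp.toLp 2 (crossProduct (WithLp.ofLp (Torus.abcCoeff 1 1 1 s))
            (Complex.I • crossProduct (fun j => (((k - s) j : ℤ) : ℂ)) (WithLp.ofLp (c (k - s))) -
              WithLp.ofLp (c (k - s)))) : EuclideanSpace ℂ (Fin 3)))⟫_ℂ).re :=
  tail_coercive_of_transcript SkewCutBracketReproductions.X0R100.unstable SkewCutBracketReproductions.X0R100.tail_gt_sqrt_two_i4 (by norm_num [SkewCutBracketReproductions.X0R100.R])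
    hx c F hcF hc0 hdiv hm

/-- Tail coercivity of `x − L_R` outside the cube of level `K3` at the **R = 100 bracket** (`x ≥ x₁ = SkewCutBracketReproductions.X0R100.x1`),
from the transcribed `SkewCutBracketReproductions.X0R100.tail_gt_sqrt_two_i3` (MODEL; not NS). -/
theorem tail_coercive_R100_i3 {x : ℝ} (hx : (SkewCutBracketReproductions.X0R100.x1 : ℝ) ≤ x)
    (c : (Fin 3 → ℤ) → EuclideanSpace ℂ (Fin 3)) (F : Finset (Fin 3 → ℤ)) (hcF : ∀ k ∉ F, c k = 0)
    (hc0 : c 0 = 0) (hdiv : ∀ k : Fin 3 → ℤ, (∑ jj : Fin 3, ((k jj : ℤ) : ℂ) * (c k) jj) = 0)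
    (hm : ∀ k ∈ F, ((SkewCutBracketReproductions.X0R100.K3 : ℝ) + 1) ^ 2 ≤ freqNormSq k) :
    0 < x + ((SkewCutBracketReproductions.X0R100.K3 : ℝ) + 1) ^ 2 / (SkewCutBracketReproductions.X0R100.R : ℝ) - Real.sqrt 2 ∧
    (x + ((SkewCutBracketReproductions.X0R100.K3 : ℝ) + 1) ^ 2 / (SkewCutBracketReproductions.X0R100.R : ℝ) - Real.sqrt 2) * ∑ k ∈ F, ‖c k‖ ^ 2 ≤
      (∑ k ∈ F, ⟪c k, ((x + freqNormSq k / (SkewCutBracketReproductions.X0R100.R : ℝ) : ℝ) : ℂ) • c k -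
        Torus.lerayCoeff k (∑ s ∈ Torus.abcFreq,
          (WithLp.toLp 2 (crossProduct (WithLp.ofLp (Torus.abcCoeff 1 1 1 s))
            (Complex.I • crossProduct (fun j => (((k - s) j : ℤ) : ℂ)) (WithLp.ofLp (c (k - s))) -
              WithLp.ofLp (c (k - s)))) : EuclideanSpace ℂ (Fin 3)))⟫_ℂ).re :=
  tail_coercive_of_transcript SkewCutBracketReproductions.X0R100.unstable SkewCutBracketReproductions.X0R100.tail_gt_sqrt_two_i3 (by norm_num [SkewCutBracketReproductions.X0R100.R])
    hx c F hcF hc0 hdiv hm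

/-- Tail coercivity of `x − L_R` outside the cube of level `K4` at the **R = 300 bracket** (`x ≥ x₁ = SkewCutBracketReproductions.X0R300.x1`),
from the transcribed `SkewCutBracketReproductions.X0R300.tail_gt_sqrt_two_i4` (MODEL; not NS). -/
theorem tail_coercive_R300_i4 {x : ℝ} (hx : (SkewCutBracketReproductions.X0R300.x1 : ℝ) ≤ x)
    (c : (Fin 3 → ℤ) → EuclideanSpace ℂ (Fin 3)) (F : Finset (Fin 3 → ℤ)) (hcF : ∀ k ∉ F, c k = 0)
    (hc0 : c 0 = 0) (hdiv : ∀ k : Fin 3 → ℤ, (∑ jj : Fin 3, ((k jj : ℤ) : ℂ) * (c k) jj) = 0)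
    (hm : ∀ k ∈ F, ((SkewCutBracketReproductions.X0R300.K4 : ℝ) + 1) ^ 2 ≤ freqNormSq k) :
    0 < x + ((SkewCutBracketReproductions.X0R300.K4 : ℝ) + 1) ^ 2 / (SkewCutBracketReproductions.X0R300.R : ℝ) - Real.sqrt 2 ∧
    (x + ((SkewCutBracketReproductions.X0R300.K4 : ℝ) + 1) ^ 2 / (SkewCutBracketReproductions.X0R300.R : ℝ) - Real.sqrt 2) * ∑ k ∈ F, ‖c k‖ ^ 2 ≤
      (∑ k ∈ F, ⟪c k, ((x + freqNormSq k / (SkewCutBracketReproductions.X0R300.R : ℝ) : ℝ) : ℂ) • c k -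
        Torus.lerayCoeff k (∑ s ∈ Torus.abcFreq,
          (WithLp.toLp 2 (crossProduct (WithLp.ofLp (Torus.abcCoeff 1 1 1 s))
            (Complex.I • crossProduct (fun j => (((k - s) j : ℤ) : ℂ)) (WithLp.ofLp (c (k - s))) -
              WithLp.ofLp (c (k - s)))) : EuclideanSpace ℂ (Fin 3)))⟫_ℂ).re :=
  tail_coercive_of_transcript SkewCutBracketReproductions.X0R300.unstable SkewCutBracketReproductions.X0R300.tail_gt_sqrt_two_i4 (by norm_num [SkewCutBracketReproductions.X0R300.R])
    hx c F hcF hc0 hdiv hm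

/-- Tail coercivity of `x − L_R` outside the cube of level `K3` at the **R = 300 bracket** (`x ≥ x₁ = SkewCutBracketReproductions.X0R300.x1`),
from the transcribed `SkewCutBracketReproductions.X0R300.tail_gt_sqrt_two_i3` (MODEL; not NS). -/
theorem tail_coercive_R300_i3 {x : ℝ} (hx : (SkewCutBracketReproductions.X0R300.x1 : ℝ) ≤ x)
    (c : (Fin 3 → ℤ) → EuclideanSpace ℂ (Fin 3)) (F : Finset (Fin 3 → ℤ)) (hcF : ∀ k ∉ F, c k = 0)
    (hc0 : c 0 = 0) (hdiv : ∀ k : Fin 3 → ℤ, (∑ jj : Fin 3, ((k jj : ℤ) : ℂ) * (c k) jj) = 0)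
    (hm : ∀ k ∈ F, ((SkewCutBracketReproductions.X0R300.K3 : ℝ) + 1) ^ 2 ≤ freqNormSq k) :
    0 < x + ((SkewCutBracketReproductions.X0R300.K3 : ℝ) + 1) ^ 2 / (SkewCutBracketReproductions.X0R300.R : ℝ) - Real.sqrt 2 ∧
    (x + ((SkewCutBracketReproductions.X0R300.K3 : ℝ) + 1) ^ 2 / (SkewCutBracketReproductions.X0R300.R : ℝ) - Real.sqrt 2) * ∑ k ∈ F, ‖c k‖ ^ 2 ≤
      (∑ k ∈ F, ⟪c k, ((x + freqNormSq k / (SkewCutBracketReproductions.X0R300.R : ℝ) : ℝ) : ℂ) • c k -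
        Torus.lerayCoeff k (∑ s ∈ Torus.abcFreq,
          (WithLp.toLp 2 (crossProduct (WithLp.ofLp (Torus.abcCoeff 1 1 1 s))
            (Complex.I • crossProduct (fun j => (((k - s) j : ℤ) : ℂ)) (WithLp.ofLp (c (k - s))) -
              WithLp.ofLp (c (k - s)))) : EuclideanSpace ℂ (Fin 3)))⟫_ℂ).re :=
  tail_coercive_of_transcript SkewCutBracketReproductions.X0R300.unstable SkewCutBracketReproductions.X0R300.tail_gt_sqrt_two_i3 (by norm_num [SkewCutBracketReproductions.X0R300.R])
    hx c F hcF hc0 hdiv hm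

/-- Tail coercivity of `x − L_R` outside the cube of level `K4` at the **R = 500 bracket** (`x ≥ x₁ = SkewCutBracketReproductions.X0R500.x1`),
from the transcribed `SkewCutBracketReproductions.X0R500.tail_gt_sqrt_two_i4` (MODEL; not NS). -/
theorem tail_coercive_R500_i4 {x : ℝ} (hx : (SkewCutBracketReproductions.X0R500.x1 : ℝ) ≤ x)
    (c : (Fin 3 → ℤ) → EuclideanSpace ℂ (Fin 3)) (F : Finset (Fin 3 → ℤ)) (hcF : ∀ k ∉ F, c k = 0)
    (hc0 : c 0 = 0) (hdiv : ∀ k : Fin 3 → ℤ, (∑ jj : Fin 3, ((k jj : ℤ) : ℂ) * (c k) jj) = 0)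
    (hm : ∀ k ∈ F, ((SkewCutBracketReproductions.X0R500.K4 : ℝ) + 1) ^ 2 ≤ freqNormSq k) :
    0 < x + ((SkewCutBracketReproductions.X0R500.K4 : ℝ) + 1) ^ 2 / (SkewCutBracketReproductions.X0R500.R : ℝ) - Real.sqrt 2 ∧
    (x + ((SkewCutBracketReproductions.X0R500.K4 : ℝ) + 1) ^ 2 / (SkewCutBracketReproductions.X0R500.R : ℝ) - Real.sqrt 2) * ∑ k ∈ F, ‖c k‖ ^ 2 ≤
      (∑ k ∈ F, ⟪c k, ((x + freqNormSq k / (SkewCutBracketReproductions.X0R500.R : ℝ) : ℝ) : ℂ) • c k -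
        Torus.lerayCoeff k (∑ s ∈ Torus.abcFreq,
          (WithLp.toLp 2 (crossProduct (WithLp.ofLp (Torus.abcCoeff 1 1 1 s))
            (Complex.I • crossProduct (fun j => (((k - s) j : ℤ) : ℂ)) (WithLp.ofLp (c (k - s))) -
              WithLp.ofLp (c (k - s)))) : EuclideanSpace ℂ (Fin 3)))⟫_ℂ).re :=
  tail_coercive_of_transcript SkewCutBracketReproductions.X0R500.unstable SkewCutBracketReproductions.X0R500.tail_gt_sqrt_two_i4 (by norm_num [SkewCutBracketReproductions.X0R500.R])
    hx c F hcF hc0 hdiv hm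

/-- Tail coercivity of `x − L_R` outside the cube of level `K3` at the **R = 500 bracket** (`x ≥ x₁ = SkewCutBracketReproductions.X0R500.x1`),
from the transcribed `SkewCutBracketReproductions.X0R500.tail_gt_sqrt_two_i3` (MODEL; not NS). -/
theorem tail_coercive_R500_i3 {x : ℝ} (hx : (SkewCutBracketReproductions.X0R500.x1 : ℝ) ≤ x)
    (c : (Fin 3 → ℤ) → EuclideanSpace ℂ (Fin 3)) (F : Finset (Fin 3 → ℤ)) (hcF : ∀ k ∉ F, c k = 0)
    (hc0 : c 0 = 0) (hdiv : ∀ k : Fin 3 → ℤ, (∑ jj : Fin 3, ((k jj : ℤ) : ℂ) * (c k) jj) = 0)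
    (hm : ∀ k ∈ F, ((SkewCutBracketReproductions.X0R500.K3 : ℝ) + 1) ^ 2 ≤ freqNormSq k) :
    0 < x + ((SkewCutBracketReproductions.X0R500.K3 : ℝ) + 1) ^ 2 / (SkewCutBracketReproductions.X0R500.R : ℝ) - Real.sqrt 2 ∧
    (x + ((SkewCutBracketReproductions.X0R500.K3 : ℝ) + 1) ^ 2 / (SkewCutBracketReproductions.X0R500.R : ℝ) - Real.sqrt 2) * ∑ k ∈ F, ‖c k‖ ^ 2 ≤
      (∑ k ∈ F, ⟪c k, ((x + freqNormSq k / (SkewCutBracketReproductions.X0R500.R : ℝ) : ℝ) : ℂ) • c k -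
        Torus.lerayCoeff k (∑ s ∈ Torus.abcFreq,
          (WithLp.toLp 2 (crossProduct (WithLp.ofLp (Torus.abcCoeff 1 1 1 s))
            (Complex.I • crossProduct (fun j => (((k - s) j : ℤ) : ℂ)) (WithLp.ofLp (c (k - s))) -
              WithLp.ofLp (c (k - s)))) : EuclideanSpace ℂ (Fin 3)))⟫_ℂ).re :=
  tail_coercive_of_transcript SkewCutBracketReproductions.X0R500.unstable SkewCutBracketReproductions.X0R500.tail_gt_sqrt_two_i3 (by norm_num [SkewCutBracketReproductions.X0R500.R])
    hx c F hcF hc0 hdiv hm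

/-- Tail coercivity of `x − L_R` outside the cube of level `K4` at the **R = 800 bracket** (`x ≥ x₁ = SkewCutBracketTranscript.X0R800.x1`),
from the transcribed `SkewCutBracketTranscript.X0R800.tail_gt_sqrt_two_i4` (MODEL; not NS). -/
theorem tail_coercive_R800_i4 {x : ℝ} (hx : (SkewCutBracketTranscript.X0R800.x1 : ℝ) ≤ x)
    (c : (Fin 3 → ℤ) → EuclideanSpace ℂ (Fin 3)) (F : Finset (Fin 3 → ℤ)) (hcF : ∀ k ∉ F, c k = 0)
    (hc0 : c 0 = 0) (hdiv : ∀ k : Fin 3 → ℤ, (∑ jj : Fin 3, ((k jj : ℤ) : ℂ) * (c k) jj) = 0)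
    (hm : ∀ k ∈ F, ((SkewCutBracketTranscript.X0R800.K4 : ℝ) + 1) ^ 2 ≤ freqNormSq k) :
    0 < x + ((SkewCutBracketTranscript.X0R800.K4 : ℝ) + 1) ^ 2 / (SkewCutBracketTranscript.X0R800.R : ℝ) - Real.sqrt 2 ∧
    (x + ((SkewCutBracketTranscript.X0R800.K4 : ℝ) + 1) ^ 2 / (SkewCutBracketTranscript.X0R800.R : ℝ) - Real.sqrt 2) * ∑ k ∈ F, ‖c k‖ ^ 2 ≤
      (∑ k ∈ F, ⟪c k, ((x + freqNormSq k / (SkewCutBracketTranscript.X0R800.R : ℝ) : ℝ) : ℂ) • c k -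
        Torus.lerayCoeff k (∑ s ∈ Torus.abcFreq,
          (WithLp.toLp 2 (crossProduct (WithLp.ofLp (Torus.abcCoeff 1 1 1 s))
            (Complex.I • crossProduct (fun j => (((k - s) j : ℤ) : ℂ)) (WithLp.ofLp (c (k - s))) -
              WithLp.ofLp (c (k - s)))) : EuclideanSpace ℂ (Fin 3)))⟫_ℂ).re :=
  tail_coercive_of_transcript SkewCutBracketTranscript.X0R800.unstable SkewCutBracketTranscript.X0R800.tail_gt_sqrt_two_i4 (by norm_num [SkewCutBracketTranscript.X0R800.R])
    hx c F hcF hc0 hdiv hm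

/-- Tail coercivity of `x − L_R` outside the cube of level `K3` at the **R = 800 bracket** (`x ≥ x₁ = SkewCutBracketTranscript.X0R800.x1`),
from the transcribed `SkewCutBracketTranscript.X0R800.tail_gt_sqrt_two_i3` (MODEL; not NS). -/
theorem tail_coercive_R800_i3 {x : ℝ} (hx : (SkewCutBracketTranscript.X0R800.x1 : ℝ) ≤ x)
    (c : (Fin 3 → ℤ) → EuclideanSpace ℂ (Fin 3)) (F : Finset (Fin 3 → ℤ)) (hcF : ∀ k ∉ F, c k = 0)
    (hc0 : c 0 = 0) (hdiv : ∀ k : Fin 3 → ℤ, (∑ jj : Fin 3, ((k jj : ℤ) : ℂ) * (c k) jj) = 0)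
    (hm : ∀ k ∈ F, ((SkewCutBracketTranscript.X0R800.K3 : ℝ) + 1) ^ 2 ≤ freqNormSq k) :
    0 < x + ((SkewCutBracketTranscript.X0R800.K3 : ℝ) + 1) ^ 2 / (SkewCutBracketTranscript.X0R800.R : ℝ) - Real.sqrt 2 ∧
    (x + ((SkewCutBracketTranscript.X0R800.K3 : ℝ) + 1) ^ 2 / (SkewCutBracketTranscript.X0R800.R : ℝ) - Real.sqrt 2) * ∑ k ∈ F, ‖c k‖ ^ 2 ≤
      (∑ k ∈ F, ⟪c k, ((x + freqNormSq k / (SkewCutBracketTranscript.X0R800.R : ℝ) : ℝ) : ℂ) • c k -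
        Torus.lerayCoeff k (∑ s ∈ Torus.abcFreq,
          (WithLp.toLp 2 (crossProduct (WithLp.ofLp (Torus.abcCoeff 1 1 1 s))
            (Complex.I • crossProduct (fun j => (((k - s) j : ℤ) : ℂ)) (WithLp.ofLp (c (k - s))) -
              WithLp.ofLp (c (k - s)))) : EuclideanSpace ℂ (Fin 3)))⟫_ℂ).re :=
  tail_coercive_of_transcript SkewCutBracketTranscript.X0R800.unstable SkewCutBracketTranscript.X0R800.tail_gt_sqrt_two_i3 (by norm_num [SkewCutBracketTranscript.X0R800.R])
    hx c F hcF hc0 hdiv hm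

/-- Tail coercivity of `x − L_R` outside the cube of level `K4` at the **R = 1000 bracket** (`x ≥ x₁ = SkewCutBracketTranscript.X0R1000.x1`),
from the transcribed `SkewCutBracketTranscript.X0R1000.tail_gt_sqrt_two_i4` (MODEL; not NS). -/
theorem tail_coercive_R1000_i4 {x : ℝ} (hx : (SkewCutBracketTranscript.X0R1000.x1 : ℝ) ≤ x)
    (c : (Fin 3 → ℤ) → EuclideanSpace ℂ (Fin 3)) (F : Finset (Fin 3 → ℤ)) (hcF : ∀ k ∉ F, c k = 0)
    (hc0 : c 0 = 0) (hdiv : ∀ k : Fin 3 → ℤ, (∑ jj : Fin 3, ((k jj : ℤ) : ℂ) * (c k) jj) = 0)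
    (hm : ∀ k ∈ F, ((SkewCutBracketTranscript.X0R1000.K4 : ℝ) + 1) ^ 2 ≤ freqNormSq k) :
    0 < x + ((SkewCutBracketTranscript.X0R1000.K4 : ℝ) + 1) ^ 2 / (SkewCutBracketTranscript.X0R1000.R : ℝ) - Real.sqrt 2 ∧
    (x + ((SkewCutBracketTranscript.X0R1000.K4 : ℝ) + 1) ^ 2 / (SkewCutBracketTranscript.X0R1000.R : ℝ) - Real.sqrt 2) * ∑ k ∈ F, ‖c k‖ ^ 2 ≤
      (∑ k ∈ F, ⟪c k, ((x + freqNormSq k / (SkewCutBracketTranscript.X0R1000.R : ℝ) : ℝ) : ℂ) • c k -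
        Torus.lerayCoeff k (∑ s ∈ Torus.abcFreq,
          (WithLp.toLp 2 (crossProduct (WithLp.ofLp (Torus.abcCoeff 1 1 1 s))
            (Complex.I • crossProduct (fun j => (((k - s) j : ℤ) : ℂ)) (WithLp.ofLp (c (k - s))) -
              WithLp.ofLp (c (k - s)))) : EuclideanSpace ℂ (Fin 3)))⟫_ℂ).re :=
  tail_coercive_of_transcript SkewCutBracketTranscript.X0R1000.unstable SkewCutBracketTranscript.X0R1000.tail_gt_sqrt_two_i4 (by norm_num [SkewCutBracketTranscript.X0R1000.R])
    hx c F hcF hc0 hdiv hm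

/-- Tail coercivity of `x − L_R` outside the cube of level `K3` at the **R = 1000 bracket** (`x ≥ x₁ = SkewCutBracketTranscript.X0R1000.x1`),
from the transcribed `SkewCutBracketTranscript.X0R1000.tail_gt_sqrt_two_i3` (MODEL; not NS). -/
theorem tail_coercive_R1000_i3 {x : ℝ} (hx : (SkewCutBracketTranscript.X0R1000.x1 : ℝ) ≤ x)
    (c : (Fin 3 → ℤ) → EuclideanSpace ℂ (Fin 3)) (F : Finset (Fin 3 → ℤ)) (hcF : ∀ k ∉ F, c k = 0)
    (hc0 : c 0 = 0) (hdiv : ∀ k : Fin 3 → ℤ, (∑ jj : Fin 3, ((k jj : ℤ) : ℂ) * (c k) jj) = 0)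
    (hm : ∀ k ∈ F, ((SkewCutBracketTranscript.X0R1000.K3 : ℝ) + 1) ^ 2 ≤ freqNormSq k) :
    0 < x + ((SkewCutBracketTranscript.X0R1000.K3 : ℝ) + 1) ^ 2 / (SkewCutBracketTranscript.X0R1000.R : ℝ) - Real.sqrt 2 ∧
    (x + ((SkewCutBracketTranscript.X0R1000.K3 : ℝ) + 1) ^ 2 / (SkewCutBracketTranscript.X0R1000.R : ℝ) - Real.sqrt 2) * ∑ k ∈ F, ‖c k‖ ^ 2 ≤
      (∑ k ∈ F, ⟪c k, ((x + freqNormSq k / (SkewCutBracketTranscript.X0R1000.R : ℝ) : ℝ) : ℂ) • c k -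
        Torus.lerayCoeff k (∑ s ∈ Torus.abcFreq,
          (WithLp.toLp 2 (crossProduct (WithLp.ofLp (Torus.abcCoeff 1 1 1 s))
            (Complex.I • crossProduct (fun j => (((k - s) j : ℤ) : ℂ)) (WithLp.ofLp (c (k - s))) -
              WithLp.ofLp (c (k - s)))) : EuclideanSpace ℂ (Fin 3)))⟫_ℂ).re :=
  tail_coercive_of_transcript SkewCutBracketTranscript.X0R1000.unstable SkewCutBracketTranscript.X0R1000.tail_gt_sqrt_two_i3 (by norm_num [SkewCutBracketTranscript.X0R1000.R])
    hx c F hcF hc0 hdiv hm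

end Summit.NavierStokesRegularity.FluidComputer.AbcLatticeTailBrackets

end
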